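import Summits.QuantumFields.BalabanUV.Beta.FP.PeriodisedBorderIndexWard
import Summits.QuantumFields.BalabanUV.Beta.SymAveragingWardRootedStencils
import Summits.QuantumFields.BalabanUV.Beta.SymShiftedSpread

/-!
# `BalabanUV.Beta.FP.PeriodisedSymBorderIndexWard` — road «FP» for binder row D1, ROUTE T, the dictionary's (J-a) «THE DOOR AT THE LITERAL OF RECORD
# (chart (III′))», item (α-1) of an2's `JA-TABLE.v1.md` (W-FP-19-23 ∕ W-an2-g39-10 «THIS ORDER — GO»): **THE SYMMETRISED BORDER TABLE `symVhSAt ρ_c`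
# INSERTED ALONG A TORUS PURE GAUGE IS THE COMMUTATOR OF THE SHIFTED SPREAD's AVERAGING ROWS WITH THE DIAGONAL GAUGE GENERATORS** — the sym twin of
# `FP/PeriodisedBorderIndexWard` (p318965-lineage, rooted chart) with `vhSAt (toSite r) ↦ symVhSAt (ctr (d+1) Lc)`, `linSymAt ↦ linSym04At`,
# `bhKStepAt d (toSite r) Lc j ↦ bhKStepSh d Lc (Dsh Lc) j`; SAME constant `c_j = (Lc^{d+1}·stepScale d Lc j)⁻¹`, SAME transports `X = −c_j•E_λ`, `X̄ = c_j•R_λ`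

WHAT.  The generic §1 of `PeriodisedBorderIndexWard` (`sum_tgrad_mul_perZ_dper_of_indexLaw`: a block-covariant, finitely supported table family with an
INDEX-slot contact law, inserted along a torus pure gauge and periodised) is fed an1's letters of the (0.4)-symmetrised border table BY NAME:
(TV) `SymAveragingHessianCounts.symVhSAt_translate`, the supports `symVhKerAt_eq_zero_left ∕ _right` and `symLinKerAt_eq_zero` lifted through the packer
`packVH` (§1), and the law (S-V)⁰⁴ `SymAveragingWardRootedStencils.divV_symVhSAt_inr_inl` in `Σ`-form (§1 `sum_symVhSAt_sub_inr_inl`: the multiplier leg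
rotates at the ROOT `x + ρ`, the fluctuation leg at its base — the rooted law's shape verbatim, contact kernel `linSym04At ρ L`).  §2
**`sum_tgrad_mul_perZ_dper_symVhSAt`** (any box `M = L·M′`, any box root `toSite r`).  §3 the (III′) averaging block: **`bhKStepSh_Dsh_inr_inl`** — the
`(inr, inl)` entry of the shifted straight spread `𝕄_j = bhKStepSh d Lc (Dsh Lc) j` is `stepScale d Lc j · Lc^{d+1} · linSym04At ρ_c Lc` at EVERY level (an1's
border dictionary `DshAn1.bhK_add_Dsh_eq_ffK_sub_smul_mfNeg_linSym04At` read where `ffK` vanishes and `mfNeg` flips the sign) ⇒ **`perZ_linSym04At_eq`**: the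
periodised contact kernel is `c_j ×` the torus averaging row of `𝕄_j`, and **`sum_tgrad_mul_perZ_dper_symVhSAt_bhKStepSh`** (the torus call's letters).  §4
matrix forms: `torus_sym_pureGauge_of_presentation ∕ _fun_of_presentation` (any box, any multiplier presentation — the Delta's coarse rows one level up),
**`torus_symQ11_pureGauge ∕ _fun`** at the (III′) torus call's types (`hQ₁₀ : Q₁₀ = perF F (bhKStepSh d Lc (Dsh Lc) j)∘((coarsePt, inr), fields)` = JA-TABLE §1's
`Q₁₀` slot, `Q₁₁^{b} := perF F (dper F (symVhSAt ρ_c d Lc rfl b.2 b.1))∘…` = its `Q₁₁` slot): `Σ_b (Dλ)_b • Q₁₁^{b} = c_j • (R_λ·Q₁₀ − Q₁₀·E_λ)` with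
`R_λ = diagonal (Σ_s tdelta F (Lc•a.1 + ρ_c) s · λ s)` (the multiplier rotates at the CENTRED root of its block), and **`torus_sym_conj_first_averaging_word`**
(the OWNER's (T-β-1) word shape).  These are the suppliers of the `q1 ∕ c1 ∕ d1` rows of the (β) instance `…RowsGradedLevelZeroSym` (next), exactly as the
rooted file supplies p320102 ∕ p314580 ∕ `PeriodisedCoarseWardContact`.  [folklore] re-indexing of finite sums BY NAME; no `def`, no `def … : Prop`,
nothing cited, 0 sorry.  Nothing of the dictionary ∕ Bałaban's asserted (whether `𝕄_j`, `symVhSAt ρ_c` ARE the literal's blocks is an2's (J-a) TABLE, not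
this file).

HONEST DEPENDENCY (page 1, mandatory): continuum YM on T⁴ ⇐ BetaPertH ∧ nine spine estimates (0/9 proved); BetaPertH ⇐ (D1) ∧ (D4) ∧ CAP+tail;
G-an2-4 gates asym, D1 and NE2/3/4.  HONEST FRAMING (cell contract, verbatim): «discharging `BetaPertH` makes Bałaban's UV stability UNCONDITIONAL —
a real constructive-QFT result; it is NOT the continuum limit and NOT the Clay problem.»  ABSOLUTE RULE (cell charter, verbatim): «No internally-minted
statement may enter as a cited fact. Every hypothesis is either kernel-proved in this package or a verbatim quotation of a PUBLISHED theorem with page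
reference. The manuscript(s) under audit are NOT citable for their own disputed steps — they are the thing under adjudication; programme-internal
(2001/route/tribunal) claims are never citable.»  0 estimates; 0∕4 row-D1 binders; NOT (T-ID), NOT (J-a) complete, NOT SDF, NOT D1, NOT BetaPertH, NOT
continuum, NOT Clay.  D1 formalisation swarm LEAF PROVER 02 (b2b-balaban-beta-d1-formalise-leaf-02 gen 21), 2026-08-22.  No existing file touched.
-/

noncomputable section

open scoped BigOperators

namespace Summit.QuantumFields.BalabanUV.Beta.FP.PeriodisedSymBorderIndexWard

open Finset Matrix
open Literature.Probability.LatticeModels (Torus.proj)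
open Literature.MathematicalPhysics.QuantumFieldTheory.Balaban1983to89
open Literature.MathematicalPhysics.QuantumFieldTheory.Balaban1983to89.Beta
open ExpKernelCalculus (MKer shiftK)
open B5Prop11Plancherel (fine)
open B6Lemma24Torus (pbox mem_pbox)
open AffineAveraging (Site box toSite unitVec)
open AveragingContours (blk off)
open AveragingContoursRooted (ctr ctrOff ctrOff_mem_box)
open AveragingHessianKernels (Near packVH_inr_inl)
open OneStepResolventKernel (Fib)
open StepJetData (mfNeg mfNeg_inr_inl)
open Summit.QuantumFields.BalabanUV.Beta.BorderedHessian (stepScale stepScale_ne_zero bhK bhKStep bhKStep_zero bhKStep_succ_inr_inl)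
open AveragingWardStencils (b6UnitVec_eq)
open Summit.QuantumFields.BalabanUV.Beta.WardLocusStencils (ffK ffK_inr_inl)
open Summit.QuantumFields.BalabanUV.Beta.DshAn1 (Dsh linSym04At linSym04At_inr_inl lin04KerAt bhK_add_Dsh_eq_ffK_sub_smul_mfNeg_linSym04At)
open Summit.QuantumFields.BalabanUV.Beta.SymAveragingHessianCounts (symVhSAt symVhSAt_translate symVhKerAt_eq_zero_left symVhKerAt_eq_zero_right symLinKerAt_eq_zero)
open Summit.QuantumFields.BalabanUV.Beta.SymAveragingWardRootedStencils (divV_symVhSAt_inr_inl lin04KerAt_eq_symLinKerAt)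
open Summit.QuantumFields.BalabanUV.Beta.SymShiftedSpread (bhKStepSh bhKStepSh_apply bhKStepSh_zero)
open Summit.QuantumFields.BalabanUV.Beta.FP.KernelPeriodisationFib (Idx perF perF_apply perZ perZ_apply)
open Summit.QuantumFields.BalabanUV.Beta.FP.KernelPeriodisationFibLoc (dper)
open Summit.QuantumFields.BalabanUV.Beta.FP.TorusGaugeCovariance (tdelta tgrad nearBox mem_nearBox)
open Summit.QuantumFields.BalabanUV.Beta.FP.TorusGaugeCovarianceCoarse (coarsePt coarsePt_coe)
open Summit.QuantumFields.BalabanUV.Beta.FP.TorusGaugeCovariancePairing (sum_tdelta_mul wrapPt_of_mem)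
open Summit.QuantumFields.BalabanUV.Beta.FP.PeriodisedBorderIndexWard (sum_tgrad_mul_perZ_dper_of_indexLaw)

variable {d : ℕ}

/-! ## §1 The letters of the symmetrised border table `symVhSAt (toSite r) d L`: translation (an1's (TV)), supports, the index-slot law (S-V)⁰⁴ in `Σ`-form -/

section Letters

variable {L : ℕ} {r : Fin (d + 1) → ℕ}

/-- [folklore] fluctuation-slot support of the `(inr, inl)` entries of `symVhSAt (toSite r)` (`symVhKerAt_eq_zero_left` through an1's packer). -/
theorem symVhSAt_inr_inl_eq_zero_of_not_mem (hr : r ∈ box (d + 1) L) (κ : Fin (d + 1)) (u x : Site (d + 1)) (μ α : Fin (d + 1))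
    {z : Site (d + 1)} (hz : z ∉ nearBox L (blk L x)) : symVhSAt (toSite r) d L rfl κ u x z (Sum.inr μ) (Sum.inl α) = 0 := by
  rw [mem_nearBox] at hz
  simp only [symVhSAt, packVH_inr_inl]
  split_ifs
  · exact symVhKerAt_eq_zero_left hr (f := (α, z)) hz _
  · rfl

/-- [folklore] family-index support of the `(inr, inl)` entries of `symVhSAt (toSite r)` (`symVhKerAt_eq_zero_right` through the packer). -/
theorem symVhSAt_inr_inl_eq_zero_of_not_mem_family (hr : r ∈ box (d + 1) L) (κ : Fin (d + 1)) (x z : Site (d + 1)) (μ α : Fin (d + 1))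
    {u : Site (d + 1)} (hu : u ∉ nearBox L (blk L x)) : symVhSAt (toSite r) d L rfl κ u x z (Sum.inr μ) (Sum.inl α) = 0 := by
  rw [mem_nearBox] at hu
  simp only [symVhSAt, packVH_inr_inl]
  split_ifs
  · exact symVhKerAt_eq_zero_right hr _ (f' := (κ, u)) hu
  · rfl

/-- [folklore] fluctuation-slot support of the (0.4) packed first-order kernel's `(inr, inl)` entry (`symLinKerAt_eq_zero`). -/
theorem linSym04At_inr_inl_eq_zero_of_not_mem (hr : r ∈ box (d + 1) L) (x : Site (d + 1)) (μ α : Fin (d + 1))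
    {z : Site (d + 1)} (hz : z ∉ nearBox L (blk L x)) : linSym04At (toSite r) L x z (Sum.inr μ) (Sum.inl α) = 0 := by
  rw [mem_nearBox] at hz
  rw [linSym04At_inr_inl]
  split_ifs
  · rw [lin04KerAt_eq_symLinKerAt]; exact symLinKerAt_eq_zero hr (f := (α, z)) hz
  · rfl

/-- [folklore] **an1's (S-V)⁰⁴ IN `Σ`-FORM ON THE `(inr, inl)` BLOCK** (`SymAveragingWardRootedStencils.divV_symVhSAt_inr_inl` with `divV` unfolded):
`Σ_κ (symVhSAt ρ κ (w − e_κ) − symVhSAt ρ κ w) x z (inr μ) (inl α) = ([x + ρ = w] − [z = w]) · linSym04At ρ L x z (inr μ) (inl α)` — the multiplier leg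
rotates at the ROOT `x + ρ`, the fluctuation leg at its base `z`, exactly as the rooted table's law. -/
theorem sum_symVhSAt_sub_inr_inl (hL : 1 ≤ L) (ρ w x z : Site (d + 1)) (μ α : Fin (d + 1)) :
    ∑ κ : Fin (d + 1), (symVhSAt ρ d L rfl κ (w - unitVec κ) x z (Sum.inr μ) (Sum.inl α) - symVhSAt ρ d L rfl κ w x z (Sum.inr μ) (Sum.inl α))
      = ((if x + ρ = w then (1 : ℝ) else 0) - (if z = w then 1 else 0)) * linSym04At ρ L x z (Sum.inr μ) (Sum.inl α) := by
  have h := divV_symVhSAt_inr_inl (d := d) hL ρ w x z μ α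
  simp only [KernelWard.divV, Finset.sum_apply, Pi.sub_apply, b6UnitVec_eq] at h
  exact h

end Letters

/-! ## §2 The symmetrised border table inserted along a torus pure gauge; the contact kernel is `c_j ×` the torus averaging row of the shifted spread -/

section Periodised

variable {M M' : Fin (d + 1) → ℕ} [∀ μ, NeZero (M μ)] {L : ℕ} [NeZero L] {r : Fin (d + 1) → ℕ}

/-- [folklore] **`sum_tgrad_mul_perZ_dper_symVhSAt` — THE SYMMETRISED BORDER TABLE INSERTED ALONG A TORUS PURE GAUGE** (`M = L·M′`, `r ∈ box`; the sym twin
of `PeriodisedBorderIndexWard.sum_tgrad_mul_perZ_dper_vhSAt` — the SAME generic lemma `sum_tgrad_mul_perZ_dper_of_indexLaw` fed an1's letters): for the torus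
gauge parameter `s`, the multiplier row `(x, μ)` and the fluctuation leg `(z, α)`,
`Σ_{u ∈ pbox M} Σ_κ tgrad M (u, inl κ) s · perZ M (dper M (symVhSAt ρ κ u)) x z (inr μ) (inl α) = (tdelta M (x + ρ) s − tdelta M z s) · perZ M (linSym04At ρ L) x z (inr μ) (inl α)`. -/
theorem sum_tgrad_mul_perZ_dper_symVhSAt (hM : ∀ i, M i = L * M' i) (hr : r ∈ box (d + 1) L) (s : ↥(pbox M)) (x z : Site (d + 1)) (μ α : Fin (d + 1)) :
    ∑ u : ↥(pbox M), ∑ κ : Fin (d + 1), tgrad M (u, Sum.inl κ) s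
        * perZ M (dper M (symVhSAt (toSite r) d L rfl κ (u : Site (d + 1)))) x z (Sum.inr μ) (Sum.inl α)
      = (tdelta M (x + toSite r) s - tdelta M z s) * perZ M (linSym04At (toSite r) L) x z (Sum.inr μ) (Sum.inl α) := by
  have hL : 1 ≤ L := Nat.one_le_iff_ne_zero.mpr (NeZero.ne L)
  exact sum_tgrad_mul_perZ_dper_of_indexLaw (symVhSAt (toSite r) d L rfl) (linSym04At (toSite r) L) (fun x => x + toSite r)
    (fun x => nearBox L (blk L x)) (fun x => nearBox L (blk L x)) (Sum.inr μ) (Sum.inl α) hM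
    (fun κ u t => symVhSAt_translate (toSite r) hL κ u t)
    (fun κ u x z hz => symVhSAt_inr_inl_eq_zero_of_not_mem hr κ u x μ α hz)
    (fun κ x z u hu => symVhSAt_inr_inl_eq_zero_of_not_mem_family hr κ x z μ α hu)
    (fun x z hz => linSym04At_inr_inl_eq_zero_of_not_mem hr x μ α hz)
    (fun w x z => sum_symVhSAt_sub_inr_inl hL (toSite r) w x z μ α) s x z

end Periodised

/-! ## §3 The shifted spread's averaging row and the (0.4) kernel: `𝕄_j (inr, inl) = stepScale j · L^{d+1} · linSym04At ρ_c` -/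

section Spread

variable (Lc : ℕ) [NeZero Lc]

/-- [folklore] **THE `(inr, inl)` ENTRY OF THE SHIFTED STRAIGHT SPREAD `𝕄_j = bhKStepSh d Lc (Dsh Lc) j` IS `stepScale d Lc j · Lc^{d+1} ·` THE (0.4) KERNEL
`linSym04At ρ_c Lc`** at every level `j` (an1's border dictionary `bhK + Dsh = ffK bhK − Lc^{d+1} • mfNeg (linSym04At ρ_c Lc)` read on the `(inr, inl)` block,
where `ffK` vanishes and `mfNeg` flips the sign; `bhKStep (j+1) = stepScale (j+1) · bhK` on the border). -/
theorem bhKStepSh_Dsh_inr_inl (j : ℕ) (x z : Site (d + 1)) (μ α : Fin (d + 1)) :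
    bhKStepSh d Lc (Dsh Lc) j x z (Sum.inr μ) (Sum.inl α)
      = stepScale d Lc j * (((Lc : ℝ) ^ (d + 1)) * linSym04At (ctr (d + 1) Lc) Lc x z (Sum.inr μ) (Sum.inl α)) := by
  have hsum : (bhK Lc + Dsh (d := d) Lc : MKer (d + 1) (Fib d)) x z (Sum.inr μ) (Sum.inl α)
      = ((Lc : ℝ) ^ (d + 1)) * linSym04At (ctr (d + 1) Lc) Lc x z (Sum.inr μ) (Sum.inl α) := by
    rw [bhK_add_Dsh_eq_ffK_sub_smul_mfNeg_linSym04At Lc, Pi.sub_apply, Pi.sub_apply, Pi.sub_apply, Pi.sub_apply, Pi.smul_apply, Pi.smul_apply,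
      Pi.smul_apply, Pi.smul_apply, ffK_inr_inl, mfNeg_inr_inl, smul_eq_mul]
    ring
  cases j with
  | zero =>
    rw [bhKStepSh_zero, hsum, stepScale, pow_zero, one_pow, one_mul]
  | succ j =>
    rw [bhKStepSh_apply, Pi.add_apply, Pi.add_apply, Pi.add_apply, Pi.add_apply, Pi.smul_apply, Pi.smul_apply, Pi.smul_apply, Pi.smul_apply, smul_eq_mul,
      bhKStep_succ_inr_inl, ← hsum, Pi.add_apply, Pi.add_apply, Pi.add_apply, Pi.add_apply]
    ring

variable {Lc} {M : Fin (d + 1) → ℕ} [∀ μ, NeZero (M μ)]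

omit [∀ μ, NeZero (M μ)] in
/-- [folklore] **THE CONTACT KERNEL IS `c_j ×` THE TORUS AVERAGING ROW OF THE SHIFTED SPREAD** (sym twin of `PeriodisedBorderIndexWard.perZ_linSymAt_eq`, the SAME
constant `c_j = (Lc^{d+1}·stepScale d Lc j)⁻¹` as the rooted chart):
`perZ M (linSym04At ρ_c Lc) x z (inr μ) (inl α) = c_j · perZ M (bhKStepSh d Lc (Dsh Lc) j) x z (inr μ) (inl α)`. -/
theorem perZ_linSym04At_eq (j : ℕ) (x z : Site (d + 1)) (μ α : Fin (d + 1)) :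
    perZ M (linSym04At (ctr (d + 1) Lc) Lc) x z (Sum.inr μ) (Sum.inl α)
      = (((Lc : ℝ) ^ (d + 1) * stepScale d Lc j)⁻¹) * perZ M (bhKStepSh d Lc (Dsh Lc) j) x z (Sum.inr μ) (Sum.inl α) := by
  have hc : ((Lc : ℝ) ^ (d + 1) * stepScale d Lc j) ≠ 0 :=
    mul_ne_zero (pow_ne_zero _ (Nat.cast_ne_zero.2 (NeZero.ne Lc))) (stepScale_ne_zero j)
  rw [perZ_apply, perZ_apply, ← tsum_mul_left]
  refine tsum_congr fun m => ?_
  rw [bhKStepSh_Dsh_inr_inl, show stepScale d Lc j * (((Lc : ℝ) ^ (d + 1)) * linSym04At (ctr (d + 1) Lc) Lc x _ (Sum.inr μ) (Sum.inl α))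
      = ((Lc : ℝ) ^ (d + 1) * stepScale d Lc j) * linSym04At (ctr (d + 1) Lc) Lc x _ (Sum.inr μ) (Sum.inl α) by ring,
    inv_mul_cancel_left₀ hc]

/-- [folklore] **IN THE (III′) TORUS CALL's LETTERS** (`M = Lc·M′`, root `ρ_c = ctr (d+1) Lc = toSite (ctrOff (d+1) Lc)`):
`Σ_u Σ_κ tgrad M (u, inl κ) s · perZ M (dper M (symVhSAt ρ_c κ u)) x z (inr μ) (inl α)
= c_j · (tdelta M (x + ρ_c) s · perZ M 𝕄_j x z (inr μ) (inl α) − perZ M 𝕄_j x z (inr μ) (inl α) · tdelta M z s)`, `𝕄_j = bhKStepSh d Lc (Dsh Lc) j`. -/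
theorem sum_tgrad_mul_perZ_dper_symVhSAt_bhKStepSh {M' : Fin (d + 1) → ℕ} (hM : ∀ i, M i = Lc * M' i) (j : ℕ) (s : ↥(pbox M)) (x z : Site (d + 1))
    (μ α : Fin (d + 1)) :
    ∑ u : ↥(pbox M), ∑ κ : Fin (d + 1), tgrad M (u, Sum.inl κ) s
        * perZ M (dper M (symVhSAt (ctr (d + 1) Lc) d Lc rfl κ (u : Site (d + 1)))) x z (Sum.inr μ) (Sum.inl α)
      = (((Lc : ℝ) ^ (d + 1) * stepScale d Lc j)⁻¹)
        * (tdelta M (x + ctr (d + 1) Lc) s * perZ M (bhKStepSh d Lc (Dsh Lc) j) x z (Sum.inr μ) (Sum.inl α)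
            - perZ M (bhKStepSh d Lc (Dsh Lc) j) x z (Sum.inr μ) (Sum.inl α) * tdelta M z s) := by
  have hLc : 1 ≤ Lc := Nat.one_le_iff_ne_zero.mpr (NeZero.ne Lc)
  rw [show ctr (d + 1) Lc = toSite (ctrOff (d + 1) Lc) from rfl, sum_tgrad_mul_perZ_dper_symVhSAt hM (ctrOff_mem_box hLc) s x z μ α,
    show toSite (ctrOff (d + 1) Lc) = ctr (d + 1) Lc from rfl, perZ_linSym04At_eq (M := M) j x z μ α]
  ring

end Spread

/-! ## §4 Matrix forms at the (III′) torus call's types: `Σ_b tgrad_{b s} • Q₁₁^{b} = c_j • (R_s·Q₁₀ − Q₁₀·E_s)`; any torus gauge function; the conjugated word -/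

section TorusCall

variable (M' : Fin (d + 1) → ℕ) [∀ μ, NeZero (M' μ)] {Lc : ℕ} [NeZero Lc]

/-- [folklore] **ANY BOX, ANY MULTIPLIER PRESENTATION** (`M = Lc·M″`; multiplier rows `a ↦ (pμ a, inr (mμ a))`, `pμ a ∈ pbox M`): for every torus gauge parameter
`s`, `Σ_b tgrad M (b.1, inl b.2) s • Q₁^{b} = c_j • (R_s * Q₀ − Q₀ * E_s)` with `Q₀ := perF M (bhKStepSh d Lc (Dsh Lc) j)∘((pμ, inr mμ), fields)` (the shifted spread's
averaging rows), `Q₁^{b} := perF M (dper M (symVhSAt ρ_c d Lc rfl b.2 b.1))∘((pμ, inr mμ), fields)` (the symmetrised border table), `E_s = diagonal (tdelta M b.1 s)`,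
`R_s = diagonal (tdelta M (pμ a + ρ_c) s)`, `c_j = (Lc^{d+1}·stepScale d Lc j)⁻¹`. -/
theorem torus_sym_pureGauge_of_presentation {M M'' : Fin (d + 1) → ℕ} [∀ μ, NeZero (M μ)] (hM : ∀ i, M i = Lc * M'' i) (j : ℕ) (s : ↥(pbox M))
    {κI : Type*} [Fintype κI] [DecidableEq κI] (pμ : κI → Site (d + 1)) (hpμ : ∀ a, pμ a ∈ pbox M) (mμ : κI → Fin (d + 1))
    {Q₀ : Matrix κI (↥(pbox M) × Fin (d + 1)) ℝ}
    (hQ₀ : Q₀ = (perF M (bhKStepSh d Lc (Dsh Lc) j)).submatrix (fun a : κI => ((⟨pμ a, hpμ a⟩, Sum.inr (mμ a)) : Idx M (Fib d)))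
        (fun b : ↥(pbox M) × Fin (d + 1) => ((b.1, Sum.inl b.2) : Idx M (Fib d)))) :
    (∑ b : ↥(pbox M) × Fin (d + 1), tgrad M (b.1, Sum.inl b.2) s •
        (perF M (dper M (symVhSAt (ctr (d + 1) Lc) d Lc rfl b.2 (b.1 : Site (d + 1))))).submatrix
          (fun a : κI => ((⟨pμ a, hpμ a⟩, Sum.inr (mμ a)) : Idx M (Fib d)))
          (fun b : ↥(pbox M) × Fin (d + 1) => ((b.1, Sum.inl b.2) : Idx M (Fib d))))
      = (((Lc : ℝ) ^ (d + 1) * stepScale d Lc j)⁻¹) •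
          (Matrix.diagonal (fun a : κI => tdelta M (pμ a + ctr (d + 1) Lc) s) * Q₀
            - Q₀ * Matrix.diagonal (fun b : ↥(pbox M) × Fin (d + 1) => tdelta M (b.1 : Site (d + 1)) s)) := by
  subst hQ₀
  ext a b'
  rw [Matrix.sum_apply, Matrix.smul_apply, Matrix.sub_apply, Matrix.diagonal_mul, Matrix.mul_diagonal, smul_eq_mul]
  simp only [Matrix.smul_apply, Matrix.submatrix_apply, perF_apply, smul_eq_mul]
  rw [Fintype.sum_prod_type]
  exact sum_tgrad_mul_perZ_dper_symVhSAt_bhKStepSh (M := M) (M' := M'') hM j s _ _ (mμ a) b'.2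

/-- [folklore] **ANY BOX, ANY MULTIPLIER PRESENTATION, ANY TORUS GAUGE FUNCTION** `λ : ↥(pbox M) → ℝ`:
`Σ_b (Dλ)_b • Q₁^{b} = c_j • (R_λ * Q₀ − Q₀ * E_λ)`, `E_λ = diagonal (λ b.1)`, `R_λ = diagonal (Σ_s tdelta M (pμ a + ρ_c) s · λ s)`. -/
theorem torus_sym_pureGauge_fun_of_presentation {M M'' : Fin (d + 1) → ℕ} [∀ μ, NeZero (M μ)] (hM : ∀ i, M i = Lc * M'' i) (j : ℕ)
    (lam : ↥(pbox M) → ℝ) {κI : Type*} [Fintype κI] [DecidableEq κI] (pμ : κI → Site (d + 1)) (hpμ : ∀ a, pμ a ∈ pbox M) (mμ : κI → Fin (d + 1))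
    {Q₀ : Matrix κI (↥(pbox M) × Fin (d + 1)) ℝ}
    (hQ₀ : Q₀ = (perF M (bhKStepSh d Lc (Dsh Lc) j)).submatrix (fun a : κI => ((⟨pμ a, hpμ a⟩, Sum.inr (mμ a)) : Idx M (Fib d)))
        (fun b : ↥(pbox M) × Fin (d + 1) => ((b.1, Sum.inl b.2) : Idx M (Fib d)))) :
    (∑ b : ↥(pbox M) × Fin (d + 1), (∑ s : ↥(pbox M), tgrad M (b.1, Sum.inl b.2) s * lam s) •
        (perF M (dper M (symVhSAt (ctr (d + 1) Lc) d Lc rfl b.2 (b.1 : Site (d + 1))))).submatrix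
          (fun a : κI => ((⟨pμ a, hpμ a⟩, Sum.inr (mμ a)) : Idx M (Fib d)))
          (fun b : ↥(pbox M) × Fin (d + 1) => ((b.1, Sum.inl b.2) : Idx M (Fib d))))
      = (((Lc : ℝ) ^ (d + 1) * stepScale d Lc j)⁻¹) •
          (Matrix.diagonal (fun a : κI => ∑ s : ↥(pbox M), tdelta M (pμ a + ctr (d + 1) Lc) s * lam s) * Q₀
            - Q₀ * Matrix.diagonal (fun b : ↥(pbox M) × Fin (d + 1) => lam b.1)) := by
  have hswap : (∑ b : ↥(pbox M) × Fin (d + 1), (∑ s : ↥(pbox M), tgrad M (b.1, Sum.inl b.2) s * lam s) •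
        (perF M (dper M (symVhSAt (ctr (d + 1) Lc) d Lc rfl b.2 (b.1 : Site (d + 1))))).submatrix
          (fun a : κI => ((⟨pμ a, hpμ a⟩, Sum.inr (mμ a)) : Idx M (Fib d)))
          (fun b : ↥(pbox M) × Fin (d + 1) => ((b.1, Sum.inl b.2) : Idx M (Fib d))))
      = ∑ s : ↥(pbox M), lam s • ∑ b : ↥(pbox M) × Fin (d + 1), tgrad M (b.1, Sum.inl b.2) s •
        (perF M (dper M (symVhSAt (ctr (d + 1) Lc) d Lc rfl b.2 (b.1 : Site (d + 1))))).submatrix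
          (fun a : κI => ((⟨pμ a, hpμ a⟩, Sum.inr (mμ a)) : Idx M (Fib d)))
          (fun b : ↥(pbox M) × Fin (d + 1) => ((b.1, Sum.inl b.2) : Idx M (Fib d))) := by
    simp only [Finset.sum_smul, Finset.smul_sum, smul_smul, mul_comm (lam _)]
    exact Finset.sum_comm
  rw [hswap, Finset.sum_congr rfl fun s _ => by rw [torus_sym_pureGauge_of_presentation hM j s pμ hpμ mμ hQ₀]]
  ext a b'
  simp only [Matrix.sum_apply, Matrix.smul_apply, Matrix.sub_apply, Matrix.diagonal_mul, Matrix.mul_diagonal, smul_eq_mul]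
  rw [show lam b'.1 = ∑ s : ↥(pbox M), tdelta M ((b'.1 : ↥(pbox M)) : Site (d + 1)) s * lam s by rw [sum_tdelta_mul, wrapPt_of_mem]]
  simp only [Finset.mul_sum, Finset.sum_mul, mul_sub, Finset.sum_sub_distrib]
  congr 1 <;> exact Finset.sum_congr rfl fun s _ => by ring

/-- [folklore] **`Q₁^{(D e_s)} = c_j·(R_s·Q₁₀ − Q₁₀·E_s)` AT THE (III′) TORUS CALL's TYPES** (fine box `fine Lc M′`; `hQ₁₀` = the shifted spread's averaging rows
`perF (bhKStepSh d Lc (Dsh Lc) j)∘((coarsePt, inr), fields)` — an2's JA-TABLE §1 `Q₁₀` slot; `Q₁₁^{b} := perF(dper(symVhSAt ρ_c d Lc rfl b.2 b.1))∘((coarsePt, inr), fields)` —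
its `Q₁₁` slot): for every torus gauge parameter `s`, `Σ_b tgrad F (b.1, inl b.2) s • Q₁₁^{b} = c_j • (R_s * Q₁₀ − Q₁₀ * E_s)` with `E_s := diagonal (tdelta F b.1 s)`
and `R_s := diagonal (tdelta F (Lc•a.1 + ρ_c) s)` (the multiplier rotates at the CENTRED root of its block). -/
theorem torus_symQ11_pureGauge (j : ℕ) (s : ↥(pbox (fine Lc M')))
    {Q₁₀ : Matrix (↥(pbox M') × Fin (d + 1)) (↥(pbox (fine Lc M')) × Fin (d + 1)) ℝ}
    (hQ₁₀ : Q₁₀ = (perF (fine Lc M') (bhKStepSh d Lc (Dsh Lc) j)).submatrix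
        (fun a : ↥(pbox M') × Fin (d + 1) => ((coarsePt M' Lc a.1, Sum.inr a.2) : Idx (fine Lc M') (Fib d)))
        (fun b : ↥(pbox (fine Lc M')) × Fin (d + 1) => ((b.1, Sum.inl b.2) : Idx (fine Lc M') (Fib d)))) :
    (∑ b : ↥(pbox (fine Lc M')) × Fin (d + 1), tgrad (fine Lc M') (b.1, Sum.inl b.2) s •
        (perF (fine Lc M') (dper (fine Lc M') (symVhSAt (ctr (d + 1) Lc) d Lc rfl b.2 (b.1 : Site (d + 1))))).submatrix
          (fun a : ↥(pbox M') × Fin (d + 1) => ((coarsePt M' Lc a.1, Sum.inr a.2) : Idx (fine Lc M') (Fib d)))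
          (fun b : ↥(pbox (fine Lc M')) × Fin (d + 1) => ((b.1, Sum.inl b.2) : Idx (fine Lc M') (Fib d))))
      = (((Lc : ℝ) ^ (d + 1) * stepScale d Lc j)⁻¹) •
          (Matrix.diagonal (fun a : ↥(pbox M') × Fin (d + 1) => tdelta (fine Lc M') ((Lc : ℤ) • (a.1 : Site (d + 1)) + ctr (d + 1) Lc) s) * Q₁₀
            - Q₁₀ * Matrix.diagonal (fun b : ↥(pbox (fine Lc M')) × Fin (d + 1) => tdelta (fine Lc M') (b.1 : Site (d + 1)) s)) := by
  subst hQ₁₀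
  ext a b'
  rw [Matrix.sum_apply, Matrix.smul_apply, Matrix.sub_apply, Matrix.diagonal_mul, Matrix.mul_diagonal, smul_eq_mul]
  simp only [Matrix.smul_apply, Matrix.submatrix_apply, perF_apply, smul_eq_mul, coarsePt_coe]
  rw [Fintype.sum_prod_type]
  exact sum_tgrad_mul_perZ_dper_symVhSAt_bhKStepSh (M := fine Lc M') (M' := M') (fun _ => rfl) j s _ _ a.2 b'.2

/-- [folklore] **ALONG ANY TORUS GAUGE FUNCTION** `λ : ↥(pbox F) → ℝ` (`(Dλ)_b := Σ_s tgrad F b s · λ s`): `Σ_b (Dλ)_b • Q₁₁^{b} = c_j • (R_λ * Q₁₀ − Q₁₀ * E_λ)`,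
`E_λ := diagonal (fun b => λ b.1)`, `R_λ := diagonal (fun a => Σ_s tdelta F (Lc•a.1 + ρ_c) s · λ s)`. -/
theorem torus_symQ11_pureGauge_fun (j : ℕ) (lam : ↥(pbox (fine Lc M')) → ℝ)
    {Q₁₀ : Matrix (↥(pbox M') × Fin (d + 1)) (↥(pbox (fine Lc M')) × Fin (d + 1)) ℝ}
    (hQ₁₀ : Q₁₀ = (perF (fine Lc M') (bhKStepSh d Lc (Dsh Lc) j)).submatrix
        (fun a : ↥(pbox M') × Fin (d + 1) => ((coarsePt M' Lc a.1, Sum.inr a.2) : Idx (fine Lc M') (Fib d)))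
        (fun b : ↥(pbox (fine Lc M')) × Fin (d + 1) => ((b.1, Sum.inl b.2) : Idx (fine Lc M') (Fib d)))) :
    (∑ b : ↥(pbox (fine Lc M')) × Fin (d + 1), (∑ s : ↥(pbox (fine Lc M')), tgrad (fine Lc M') (b.1, Sum.inl b.2) s * lam s) •
        (perF (fine Lc M') (dper (fine Lc M') (symVhSAt (ctr (d + 1) Lc) d Lc rfl b.2 (b.1 : Site (d + 1))))).submatrix
          (fun a : ↥(pbox M') × Fin (d + 1) => ((coarsePt M' Lc a.1, Sum.inr a.2) : Idx (fine Lc M') (Fib d)))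
          (fun b : ↥(pbox (fine Lc M')) × Fin (d + 1) => ((b.1, Sum.inl b.2) : Idx (fine Lc M') (Fib d))))
      = (((Lc : ℝ) ^ (d + 1) * stepScale d Lc j)⁻¹) •
          (Matrix.diagonal (fun a : ↥(pbox M') × Fin (d + 1) =>
              ∑ s : ↥(pbox (fine Lc M')), tdelta (fine Lc M') ((Lc : ℤ) • (a.1 : Site (d + 1)) + ctr (d + 1) Lc) s * lam s) * Q₁₀
            - Q₁₀ * Matrix.diagonal (fun b : ↥(pbox (fine Lc M')) × Fin (d + 1) => lam b.1)) :=
  torus_sym_pureGauge_fun_of_presentation (M := fine Lc M') (M'' := M') (fun _ => rfl) j lam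
    (fun a : ↥(pbox M') × Fin (d + 1) => (coarsePt M' Lc a.1 : Site (d + 1))) (fun a => (coarsePt M' Lc a.1).2) (fun a => a.2) hQ₁₀

/-- [folklore] **(T-β-1) AT ORDER 1 FOR THE AVERAGING BLOCK OF THE (III′) LITERAL, IN THE OWNER's WORD SHAPE** (sym twin of
`PeriodisedBorderIndexWard.torus_conj_first_averaging_word`): with `A₀ = Ā₀ = 1`, `A₁ := −c_j • E_λ`, `Ā₁ := c_j • R_λ` (SAME transports as the rooted chart —
JA-TABLE §1 «`X`, `X̄` unchanged»), for ANY direction `h`: `Ā₁ * Q₁₀ * A₀ + Ā₀ * Q₁^{(h)} * A₀ + Ā₀ * Q₁₀ * A₁ = Q₁^{(h + Dλ)}` with `Q₁^{(h)} := Σ_b h b • Q₁₁^{b}`. -/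
theorem torus_sym_conj_first_averaging_word (j : ℕ) (h : ↥(pbox (fine Lc M')) × Fin (d + 1) → ℝ) (lam : ↥(pbox (fine Lc M')) → ℝ)
    {Q₁₀ : Matrix (↥(pbox M') × Fin (d + 1)) (↥(pbox (fine Lc M')) × Fin (d + 1)) ℝ}
    (hQ₁₀ : Q₁₀ = (perF (fine Lc M') (bhKStepSh d Lc (Dsh Lc) j)).submatrix
        (fun a : ↥(pbox M') × Fin (d + 1) => ((coarsePt M' Lc a.1, Sum.inr a.2) : Idx (fine Lc M') (Fib d)))
        (fun b : ↥(pbox (fine Lc M')) × Fin (d + 1) => ((b.1, Sum.inl b.2) : Idx (fine Lc M') (Fib d)))) :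
    ((((Lc : ℝ) ^ (d + 1) * stepScale d Lc j)⁻¹) •
          Matrix.diagonal (fun a : ↥(pbox M') × Fin (d + 1) =>
            ∑ s : ↥(pbox (fine Lc M')), tdelta (fine Lc M') ((Lc : ℤ) • (a.1 : Site (d + 1)) + ctr (d + 1) Lc) s * lam s)) * Q₁₀
          * (1 : Matrix (↥(pbox (fine Lc M')) × Fin (d + 1)) (↥(pbox (fine Lc M')) × Fin (d + 1)) ℝ)
        + (1 : Matrix (↥(pbox M') × Fin (d + 1)) (↥(pbox M') × Fin (d + 1)) ℝ) * (∑ b : ↥(pbox (fine Lc M')) × Fin (d + 1), h b •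
            (perF (fine Lc M') (dper (fine Lc M') (symVhSAt (ctr (d + 1) Lc) d Lc rfl b.2 (b.1 : Site (d + 1))))).submatrix
              (fun a : ↥(pbox M') × Fin (d + 1) => ((coarsePt M' Lc a.1, Sum.inr a.2) : Idx (fine Lc M') (Fib d)))
              (fun b : ↥(pbox (fine Lc M')) × Fin (d + 1) => ((b.1, Sum.inl b.2) : Idx (fine Lc M') (Fib d))))
          * (1 : Matrix (↥(pbox (fine Lc M')) × Fin (d + 1)) (↥(pbox (fine Lc M')) × Fin (d + 1)) ℝ)
        + (1 : Matrix (↥(pbox M') × Fin (d + 1)) (↥(pbox M') × Fin (d + 1)) ℝ) * Q₁₀ * (-((((Lc : ℝ) ^ (d + 1) * stepScale d Lc j)⁻¹) •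
            Matrix.diagonal (fun b : ↥(pbox (fine Lc M')) × Fin (d + 1) => lam b.1)))
      = ∑ b : ↥(pbox (fine Lc M')) × Fin (d + 1), (h b + ∑ s : ↥(pbox (fine Lc M')), tgrad (fine Lc M') (b.1, Sum.inl b.2) s * lam s) •
          (perF (fine Lc M') (dper (fine Lc M') (symVhSAt (ctr (d + 1) Lc) d Lc rfl b.2 (b.1 : Site (d + 1))))).submatrix
            (fun a : ↥(pbox M') × Fin (d + 1) => ((coarsePt M' Lc a.1, Sum.inr a.2) : Idx (fine Lc M') (Fib d)))
            (fun b : ↥(pbox (fine Lc M')) × Fin (d + 1) => ((b.1, Sum.inl b.2) : Idx (fine Lc M') (Fib d))) := by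
  rw [Matrix.mul_one, Matrix.mul_one, Matrix.one_mul, Matrix.one_mul, Matrix.mul_neg, Matrix.mul_smul, Matrix.smul_mul]
  simp only [add_smul, Finset.sum_add_distrib]
  rw [torus_symQ11_pureGauge_fun M' j lam hQ₁₀, smul_sub]
  abel

end TorusCall

end Summit.QuantumFields.BalabanUV.Beta.FP.PeriodisedSymBorderIndexWard

end
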